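import Literature.Geometry.Lorentzian.CarterLayerBarrierRadii
import Literature.Geometry.Lorentzian.CarterLayerBarrierBrackets
import Literature.Geometry.Lorentzian.CarterLayerCollar
import HarnessLib

/-!
# Geometry of the Breitenlohner–Freedman barrier of Carter's equation in the threshold sliver:
# points, floors and the last Airy layer
(namespace `Literature.Geometry.Lorentzian.Kerr`.)

The sliver companion of `CarterThresholdBarrierGeometry.threshold_barrier_geometry`, continuing
`CarterLayerBarrierRadii`. Under the hypotheses of `layer_barrier_radii` with the stronger
`E* ≤ θ₁Λ′/12288`, a collar parameter `θ > 0` with `θ(r₊ − r₋) ≤ θ₁M/8`, and the cap inside the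
collar and the first horizon width (`2X* ≤ θ(r₊ − r₋)`, `X* ≤ r₊ − r₋`):

* `layer_barrier_geometry` — `b₁, b₂, s_θ, s_lo, s_mid, L, K_L, k₀, k₁` with `{φ ≤ 0} = [b₁, b₂]`,
  `φ b₂ = 0`, `ρ b₂ < R`, `(1 + θ₁/2)r₊ ≤ ρ b₂`, `ρ s_θ = r₊ + θ(r₊ − r₋)`,
  `b₁ < s_θ ≤ s_lo < s_mid ≤ b₂ − L`, floors `k₀²` on `[s_θ, b₂ − L]`, `k₁²` on `[s_lo, s_mid]`, the
  layer `|V∘ρ − ω²| ≤ K_L²` on `[b₂ − L, b₂]`, `K_L L ≤ 1`, and the bookkeeping facts of the threshold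
  case with `L ≤ 92160f·ρ b₂/(ω²δ²)` and `k₀² ≥ min(Δ(r_θ)θ₁ω²/(512(ρ b₂)²), 3δ²/(4(ρ b₂)⁴))`.

Input geometry of `OneBarrierKernelBound` in the sliver case of the near-extremal Kerr programme
(crux `KappaExplicitWaveDecay`, BF-stable large-`Λ` kernel bound).

## References
* M. Dafermos, I. Rodnianski, Y. Shlapentokh-Rothman, arXiv:1402.7034 = Ann. of Math. 183 (2016),
  §§2.1.2, 5.2.3, 6.2–6.5, 8.7 (key `DafermosRodnianskiShlapentokhrothman2014`). Assembly folklore.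
-/

noncomputable section

open Set Filter

namespace Literature.Geometry.Lorentzian

namespace Kerr

section LayerGeometry

variable {M a ω Λ : ℝ} {m : ℤ} {ρ : ℝ → ℝ}

/-! ### The points, floors and layer -/

set_option maxHeartbeats 400000 in
-- one long assembly of landed facts; the arithmetic is delegated to the `…BarrierConstants` files
/-- **Geometry of the sliver barrier.** Under the hypotheses of `layer_barrier_radii` with the stronger
`E* ≤ θ₁Λ′/12288`, a collar parameter `θ > 0` with `θ(r₊ − r₋) ≤ θ₁M/8` and the cap inside the collar
`2X* ≤ θ(r₊ − r₋)`: the points `s_θ ≤ s_lo < s_mid ≤ b₂ − L` (`b₁ < s_θ`), floors, layer and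
bookkeeping inequalities listed in the module docstring. [folklore] -/
theorem layer_barrier_geometry (hρ : IsTortoiseRadius M a ρ) (hMa : IsSubextremal M a)
    (hadm : IsAdmissibleTriple a ω m Λ) (hΛ1 : 1 ≤ Λ) (hσ : ω - m * horizonAngularVelocity M a ≠ 0)
    (hω : ω ≠ 0) {θ₁ : ℝ} (hθ₁ : 0 < θ₁) (hθ₁1 : θ₁ ≤ 1)
    (hBF : (1 + θ₁) * (2 * rPlus M a * ω) ^ 2 ≤ Λ - 2 * a * m * ω)
    (hd : rPlus M a - rMinus M a ≤ θ₁ * M / 4) {θ : ℝ} (hθ : 0 < θ)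
    (hθd : θ * (rPlus M a - rMinus M a) ≤ θ₁ * M / 8) {Es f Xs Xl : ℝ}
    (hEs : Es = ((rPlus M a ^ 2 + a ^ 2) * (ω - m * horizonAngularVelocity M a)) ^ 2 / (θ₁ * M / 8) ^ 2 +
      2 * |(rPlus M a ^ 2 + a ^ 2) * (ω - m * horizonAngularVelocity M a)| * |ω| *
        (1 + (rPlus M a + rMinus M a) / (θ₁ * M / 8)))
    (hf : f = 1 + 25 * Es / θ₁) (hΛ' : 3.5e10 * f ^ 2 / θ₁ ^ 3 ≤ Λ - 2 * a * m * ω)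
    (hEΛ : Es ≤ θ₁ * (Λ - 2 * a * m * ω) / 12288)
    (hXs : Xs = 24 * ((rPlus M a ^ 2 + a ^ 2) * (ω - m * horizonAngularVelocity M a)) ^ 2 /
      ((rPlus M a - rMinus M a) * θ₁ ^ 2 * (Λ - 2 * a * m * ω)))
    (hXl : Xl = ((rPlus M a ^ 2 + a ^ 2) * (ω - m * horizonAngularVelocity M a)) ^ 2 /
      (8 * (rPlus M a - rMinus M a) * (|Λ - 2 * a * m * ω| + 3)))
    (h2Xs : 2 * Xs ≤ θ * (rPlus M a - rMinus M a)) (hXsd : Xs ≤ rPlus M a - rMinus M a)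
    (hK : 6 * rPlus M a * |ω| * Xl ≤ (rPlus M a ^ 2 + a ^ 2) * |ω - m * horizonAngularVelocity M a|)
    (hord : (Ioi (rPlus M a) ∩ {r : ℝ | ω ^ 2 ≤ sepPotential M a ω m Λ r}).OrdConnected) :
    ∃ b₁ b₂ sθ slo smid L KL k₀ k₁ : ℝ,
      {s | ω ^ 2 - sepPotential M a ω m Λ (ρ s) ≤ 0} = Icc b₁ b₂ ∧
      ω ^ 2 - sepPotential M a ω m Λ (ρ b₂) = 0 ∧
      ρ b₂ < max (7 * M) (max (Real.sqrt (12 * Λ) / |ω|) (1 / (M * ω ^ 2))) ∧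
      (1 + θ₁ / 2) * rPlus M a ≤ ρ b₂ ∧
      ρ sθ = rPlus M a + θ * (rPlus M a - rMinus M a) ∧ b₁ < sθ ∧
      sθ ≤ slo ∧ slo < smid ∧ smid ≤ b₂ - L ∧ 0 < L ∧
      0 < k₀ ∧ (∀ s ∈ Icc sθ (b₂ - L), k₀ ^ 2 ≤ sepPotential M a ω m Λ (ρ s) - ω ^ 2) ∧
      0 < k₁ ∧ (∀ s ∈ Icc slo smid, k₁ ^ 2 ≤ sepPotential M a ω m Λ (ρ s) - ω ^ 2) ∧
      0 ≤ KL ∧ (∀ s ∈ Icc (b₂ - L) b₂, |sepPotential M a ω m Λ (ρ s) - ω ^ 2| ≤ KL ^ 2) ∧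
      KL * L ≤ 1 ∧
      (ρ b₂ - rPlus M a) / 4 ≤ smid - slo ∧
      ω ^ 2 * (ρ b₂ - rPlus M a) ^ 5 / (1024 * ρ b₂ ^ 5) ≤ k₁ ^ 2 ∧
      min (delta M a (rPlus M a + θ * (rPlus M a - rMinus M a)) * (θ₁ * ω ^ 2 / (512 * ρ b₂ ^ 2)))
        (3 * (ρ b₂ - rPlus M a) ^ 2 / (4 * ρ b₂ ^ 4)) ≤ k₀ ^ 2 ∧
      3 * ρ b₂ / (ω ^ 2 * (ρ b₂ - rPlus M a) ^ 2) ≤ L ∧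
      L ≤ 92160 * f * ρ b₂ / (ω ^ 2 * (ρ b₂ - rPlus M a) ^ 2) ∧
      Λ - 2 * a * m * ω ≤ 4 * ω ^ 2 * ρ b₂ ^ 2 ∧ 1 ≤ f := by
  have ha : |a| < M := hMa
  have hM : 0 < M := hMa.pos
  have hrp : 0 < rPlus M a := rPlus_pos hM a
  have hMr : M ≤ rPlus M a := M_le_rPlus M a
  have hrm : rMinus M a < rPlus M a := hMa.rMinus_lt_rPlus
  have hrm0 : 0 ≤ rMinus M a := rMinus_nonneg_of_abs_le ha.le
  have hω2 : 0 < ω ^ 2 := by positivity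
  have hζ : 0 < θ₁ * M / 8 := by positivity
  have hθM : θ₁ * M ≤ θ₁ * rPlus M a := mul_le_mul_of_nonneg_left hMr hθ₁.le
  have ha2 : a ^ 2 ≤ rPlus M a ^ 2 := by
    have h1 : |a| ≤ rPlus M a := ha.le.trans hMr
    nlinarith [sq_abs a, abs_nonneg a]
  have hΛ'pos : 0 < Λ - 2 * a * m * ω := by
    have e : (1 + θ₁) * (2 * rPlus M a * ω) ^ 2 = (1 + θ₁) * (4 * rPlus M a ^ 2) * ω ^ 2 := by ring
    have : 0 < (1 + θ₁) * (4 * rPlus M a ^ 2) * ω ^ 2 := by positivity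
    linarith only [hBF, e, this]
  set Λ' := Λ - 2 * a * m * ω with hΛ'def
  have hd0 : 0 < rPlus M a - rMinus M a := sub_pos.2 hrm
  have hXs0 : 0 < Xs := by
    rw [hXs]
    have : 0 < ((rPlus M a ^ 2 + a ^ 2) * (ω - m * horizonAngularVelocity M a)) ^ 2 := by positivity
    positivity
  have hXsθ : Xs ≤ θ₁ * rPlus M a / 8 := by linarith only [h2Xs, hXs0, hθd, hθM]
  have hEΛ' : Es ≤ θ₁ * Λ' / 192 := by
    have : 0 ≤ θ₁ * Λ' := by positivity
    linarith only [hEΛ, this]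
  obtain ⟨b₁, b₂, rt, hF, hφb₂, hb₂R, hb1u, hrb_lo, hrt, hrtd, hJrt, hgap1, hgap2, hΛ4, hΛ8, hbig1, hbig2,
      hEs0, hf1, hprof⟩ :=
    layer_barrier_radii hρ hMa hadm hΛ1 hσ hω hθ₁ hθ₁1 hBF hd hEs hf hΛ' hEΛ' hXs hXl hXsd hXsθ hK hord
  set rb := ρ b₂ with hrbdef
  set δ := rb - rPlus M a with hδdef
  set d := rPlus M a - rMinus M a with hddef
  have hrbeq : rPlus M a + δ = rb := by rw [hδdef]; ring
  have erm : (1 + θ₁ / 2) * rPlus M a = rPlus M a + θ₁ * rPlus M a / 2 := by ring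
  have hδlo : θ₁ * rPlus M a / 2 ≤ δ := by rw [hδdef]; linarith only [hrb_lo, erm]
  have hδM : θ₁ * M / 2 ≤ δ := by linarith only [hδlo, hθM]
  have hδ : 0 < δ := lt_of_lt_of_le (by positivity) hδM
  have hrb0 : 0 < rb := by linarith only [hδ, hδdef, hrp]
  have hdδ : d ≤ δ / 2 := by linarith only [hd, hδM, hddef]
  have hδrb : δ ≤ rb := by linarith only [hδdef, hrp]
  have hrbp0 : 0 < rb + rPlus M a := by linarith only [hrb0, hrp]
  have hrtp0 : 0 < rt + rPlus M a := by linarith only [hrt, hrp]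
  have hrθp : rPlus M a < rPlus M a + θ * d := lt_add_of_pos_right _ (mul_pos hθ hd0)
  have hrlop : rPlus M a < rPlus M a + δ / 2 := by linarith only [hδ]
  have hrmidp : rPlus M a < rPlus M a + 3 * δ / 4 := by linarith only [hδ]
  obtain ⟨sθ, hsθ⟩ := hρ.exists_apply_eq hrθp
  obtain ⟨slo, hslo⟩ := hρ.exists_apply_eq hrlop
  obtain ⟨smid, hsmid⟩ := hρ.exists_apply_eq hrmidp
  have hθ8 : θ * d ≤ θ₁ * rPlus M a / 8 := by linarith only [hθd, hθM, hddef]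
  have hθlo : sθ ≤ slo := by
    rw [← hρ.le_iff_le hMa, hsθ, hslo]; linarith only [hθ8, hδlo, hδ]
  have hlomid : slo < smid := by
    rw [← hρ.lt_iff_lt hMa, hslo, hsmid]; linarith only [hδ]
  have hmidb : smid ≤ b₂ := by
    rw [← hρ.le_iff_le hMa, hsmid, ← hrbdef]; linarith only [hδdef, hδ]
  have hb₁θ : b₁ < sθ := by
    rw [← hρ.lt_iff_lt hMa, hsθ]; linarith only [hb1u, h2Xs, hXs0, hddef]
  have hℓ : δ / 4 ≤ smid - slo := by
    have h := hρ.apply_sub_apply_le_sub hMa hlomid.le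
    rw [hslo, hsmid] at h; linarith only [h]
  have hℓ₂ : δ / 4 ≤ b₂ - smid := by
    have h := hρ.apply_sub_apply_le_sub hMa hmidb
    rw [hsmid, ← hrbdef] at h; linarith only [h, hδdef]
  have hlot : rPlus M a + δ / 2 + δ / 4 ≤ rt := by linarith only [hgap1, hδdef]
  have hrt3 : rt + rPlus M a ≤ 3 * (rPlus M a + δ) := by linarith only [hgap2, hδdef, hrp, hδ]
  have hrt2 : rPlus M a + δ + rPlus M a ≤ 2 * (rt + rPlus M a) := by linarith only [hlot, hδ, hrp]
  have hsloζ : rPlus M a + θ₁ * M / 8 ≤ ρ slo := by rw [hslo]; linarith only [hδM, hζ]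
  have hb₂d : rPlus M a - rMinus M a ≤ ρ b₂ - rPlus M a := by
    rw [← hrbdef]; linarith only [hdδ, hδdef, hddef, hδ]
  -- the affine bounds on `[s_lo, b₂]`, constants in abstract form
  have hV : sepPotential M a ω m Λ (ρ b₂) = ω ^ 2 := by linarith only [hφb₂]
  set F₁ := 2 * (3 + Es) * (rPlus M a + δ + rPlus M a) / (rt + rPlus M a) + 3 + 2 * Es with hF₁def
  set Cb := 2 * (rt + rPlus M a) + (rt + rPlus M a) ^ 2 / (rPlus M a + δ / 2 - rMinus M a) with hCbdef
  set F₂ := ω ^ 2 * Cb * (Es / (ω ^ 2 * (rPlus M a + δ + rPlus M a))) + 3 + Es with hF₂def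
  set c₁ := 2 * ω ^ 2 * (rPlus M a + δ / 2 + rPlus M a) *
      ((rPlus M a + δ / 2 - rPlus M a) / (rPlus M a + δ / 2 - rMinus M a)) *
      ((rPlus M a + δ / 2 - rPlus M a) * (rPlus M a + δ / 2 - rMinus M a)) ^ 2 /
      ((rPlus M a + δ) ^ 2 + a ^ 2) ^ 3 with hc₁
  set e₁ := (rPlus M a + δ - rPlus M a) * (rPlus M a + δ - rMinus M a) * F₁ /
      ((rPlus M a + δ / 2) ^ 2 + a ^ 2) ^ 2 with he₁
  set c₂ := ω ^ 2 * Cb * ((rPlus M a + δ - rPlus M a) * (rPlus M a + δ - rMinus M a)) ^ 2 /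
      ((rPlus M a + δ / 2) ^ 2 + a ^ 2) ^ 3 with hc₂
  set e₂ := (rPlus M a + δ - rPlus M a) * (rPlus M a + δ - rMinus M a) * F₂ /
      ((rPlus M a + δ / 2) ^ 2 + a ^ 2) ^ 2 with he₂
  have haff : ∀ s ∈ Icc slo b₂, c₁ * (b₂ - s) - e₁ ≤ sepPotential M a ω m Λ (ρ s) - ω ^ 2 ∧
      sepPotential M a ω m Λ (ρ s) - ω ^ 2 ≤ c₂ * (b₂ - s) + e₂ := by
    intro s hs
    have h := negCoeff_affine_bounds_tortoise_of_layer (Λ := Λ) hρ hMa hω hEs0 hζ hrt hrtd hJrt hprof hV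
      hb₂d hsloζ hs
    rw [hslo, ← hrbdef, ← hrbeq] at h
    simp only [delta_eq_mul ha.le] at h
    exact h
  -- the brackets: `3 ≤ F₁ ≤ 15 f`, `0 ≤ F₂ ≤ 3 f`
  have hδθ : θ₁ * (rPlus M a + δ) ≤ 3 * δ := by
    have h1 : θ₁ * δ ≤ δ := mul_le_of_le_one_left hδ.le hθ₁1
    nlinarith only [h1, hδlo]
  have hrt1 : rt + rPlus M a ≤ 2 * (rPlus M a + δ) := by linarith only [hgap2, hδdef, hδ, hrbeq]
  obtain ⟨hF₁3, hF₁le⟩ := layerBracket_F₁ (rp := rPlus M a) (δ := δ) hEs0 hθ₁ hθ₁1 hf hrtp0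
    (by linarith only [hrp, hδ]) hrt2
  obtain ⟨hCb0, hF₂0, hF₂le⟩ := layerBracket_F₂ (rm := rMinus M a) hω hEs0 hθ₁ hθ₁1 hf hrp hd0.le hδ
    hrtp0 hrt1 hδθ
  rw [← hF₁def] at hF₁3 hF₁le
  rw [← hCbdef] at hCb0 hF₂0 hF₂le
  rw [← hF₂def] at hF₂0 hF₂le
  have hF₁0 : 0 ≤ F₁ := by linarith only [hF₁3]
  have hc₁ge : ω ^ 2 * δ ^ 4 / (128 * (rPlus M a + δ) ^ 5) ≤ c₁ :=
    thresholdBarrier_c₁_ge hrp hrm hδ ha2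
  have hc₁le : c₁ ≤ ω ^ 2 * δ ^ 4 / (2 * (rPlus M a + δ) ^ 5) :=
    thresholdBarrier_c₁_le hrp hrm hδ hdδ
  have he₁ge : 3 * δ ^ 2 / (4 * (rPlus M a + δ) ^ 4) ≤ e₁ :=
    layerBarrier_e₁_ge hrp hrm hδ ha2 hF₁3
  have he₁le : e₁ ≤ 360 * f * δ ^ 2 / (rPlus M a + δ) ^ 4 :=
    layerBarrier_e₁_le hrp hrm hδ hdδ hf1 hF₁0 hF₁le
  have hc₂le : c₂ ≤ 3456 * ω ^ 2 * δ ^ 3 / (rPlus M a + δ) ^ 4 := by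
    have h := layerBarrier_c₂_le (a := a) (ω := ω) hrp hrm hδ hdδ hrt hrt3
    rw [hc₂, hCbdef]; exact h
  have he₂le : e₂ ≤ 72 * f * δ ^ 2 / (rPlus M a + δ) ^ 4 :=
    layerBarrier_e₂_le hrp hrm hδ hdδ hf1 hF₂0 hF₂le
  rw [hrbeq] at hc₁ge hc₁le he₁ge he₁le hc₂le he₂le
  have hc₂0 : 0 ≤ c₂ := by
    have h3 : 0 < rPlus M a + δ / 2 := by linarith only [hrp, hδ]
    rw [hc₂]
    exact div_nonneg (mul_nonneg (mul_nonneg hω2.le hCb0) (sq_nonneg _)) (by positivity)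
  have he₂0 : 0 ≤ e₂ := by
    rw [he₂]
    have h3 : 0 < rPlus M a + δ / 2 := by linarith only [hrp, hδ]
    refine div_nonneg (mul_nonneg (mul_nonneg ?_ ?_) hF₂0) (by positivity)
    · linarith only [hδ]
    · linarith only [hδ, hrm]
  clear_value c₁ e₁ c₂ e₂ F₁ F₂ Cb
  have hf0 : 0 < f := by linarith only [hf1]
  have hc₁0 : 0 < c₁ := lt_of_lt_of_le (by positivity) hc₁ge
  have he₁0 : 0 < e₁ := lt_of_lt_of_le (by positivity) he₁ge
  have h8 : 8 * e₁ ≤ c₁ * δ := layerBarrier_eight_e₁_le hδ hrb0 hf1 hc₁ge he₁le hbig1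
  set L := 2 * e₁ / c₁ with hLdef
  obtain ⟨hL1, hL2⟩ := layerBarrier_ratio_bounds hω hδ hrb0 hf1 hc₁ge hc₁le he₁ge he₁le
  rw [← hLdef] at hL1 hL2
  have hL0 : 0 < L := by rw [hLdef]; positivity
  have hLδ : L ≤ δ / 4 := by
    rw [hLdef, div_le_iff₀ hc₁0]; linarith only [h8]
  have hmidβ : smid ≤ b₂ - L := by linarith only [hℓ₂, hLδ]
  have hcL : c₁ * L = 2 * e₁ := by rw [hLdef]; field_simp
  have hlay : (c₂ * L + e₁ + e₂) * L ^ 2 ≤ 1 :=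
    layerBarrier_layer_le_one hω hδ hrb0 hδrb hf1 hc₁ge hc₁le he₁ge he₁le hc₂le he₂le hLdef hbig2
  clear_value L
  have hKL2 : 0 ≤ c₂ * L + e₁ + e₂ := by nlinarith only [hc₂0, hL0, he₁0, he₂0]
  set KL := Real.sqrt (c₂ * L + e₁ + e₂) with hKLdef
  have hKLsq : KL ^ 2 = c₂ * L + e₁ + e₂ := Real.sq_sqrt hKL2
  have hKL0 : 0 ≤ KL := Real.sqrt_nonneg _
  clear_value KL
  have hKLL : KL * L ≤ 1 := by
    have h1 : (KL * L) ^ 2 ≤ 1 := by rw [mul_pow, hKLsq]; linarith only [hlay]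
    have h2 : 0 ≤ KL * L := mul_nonneg hKL0 hL0.le
    nlinarith only [h1, h2]
  -- the collar floors: inner (sliver) and outer (layer)
  have hΔθ : 0 < delta M a (rPlus M a + θ * d) := delta_pos ha.le hrθp
  have hr18p : rPlus M a < rPlus M a * (1 + θ₁ / 8) := by nlinarith only [hrp, hθ₁]
  have hΔ18 : delta M a (rPlus M a + θ * d) ≤ delta M a (rPlus M a * (1 + θ₁ / 8)) :=
    IsTortoiseRadius.delta_le_delta hMa hrθp.le (by nlinarith only [hθ8])
  set Jlo := 2 * ω ^ 2 * (rPlus M a + δ / 2 + rPlus M a) *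
      ((rPlus M a + δ / 2 - rPlus M a) / (rPlus M a + δ / 2 - rMinus M a)) *
      (rt - (rPlus M a + δ / 2)) with hJlodef
  -- `J_lo/(r_lo² + a²)² ≥ ω² δ/(32 r_b³)` (as at the threshold) and `E ≤ J_lo/2`
  have hA4 : ((rPlus M a + δ / 2) ^ 2 + a ^ 2) ^ 2 ≤ 4 * rb ^ 4 := by
    have h5 : (rPlus M a + δ / 2) ^ 2 + a ^ 2 ≤ 2 * rb ^ 2 := by
      rw [← hrbeq]; nlinarith only [ha2, hδ, hrp]
    calc ((rPlus M a + δ / 2) ^ 2 + a ^ 2) ^ 2 ≤ (2 * rb ^ 2) ^ 2 :=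
          pow_le_pow_left₀ (by positivity) h5 2
      _ = 4 * rb ^ 4 := by ring
  have hAlo0 : 0 < ((rPlus M a + δ / 2) ^ 2 + a ^ 2) ^ 2 := by
    have : 0 < rPlus M a + δ / 2 := by linarith only [hrp, hδ]
    positivity
  have hJlo : ω ^ 2 * δ * rb / 8 ≤ Jlo := by
    have h1 : rb / 2 ≤ rPlus M a + δ / 2 + rPlus M a := by linarith only [hrbeq, hrp]
    have h2 : 1 / 2 ≤ (rPlus M a + δ / 2 - rPlus M a) / (rPlus M a + δ / 2 - rMinus M a) := by
      rw [le_div_iff₀ (by linarith only [hrm, hδ])]; linarith only [hdδ, hddef]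
    have h3 : δ / 4 ≤ rt - (rPlus M a + δ / 2) := by linarith only [hlot]
    rw [hJlodef]
    calc ω ^ 2 * δ * rb / 8 = 2 * ω ^ 2 * (rb / 2) * (1 / 2) * (δ / 4) := by ring
      _ ≤ 2 * ω ^ 2 * (rPlus M a + δ / 2 + rPlus M a) *
            ((rPlus M a + δ / 2 - rPlus M a) / (rPlus M a + δ / 2 - rMinus M a)) *
            (rt - (rPlus M a + δ / 2)) := by
          gcongr
  have hωδ : 0 < ω ^ 2 * δ * rb := by positivity
  have hEJ : Es ≤ Jlo / 2 := by
    -- `E ≤ θ₁Λ′/12288`, `θ₁Λ′ ≤ 4θ₁ω²r_b² ≤ 12 ω²δ r_b`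
    have hδθ : θ₁ * rb ≤ 3 * δ := by
      have e : θ₁ * rb = θ₁ * rPlus M a + θ₁ * δ := by rw [hδdef]; ring
      have h1 : θ₁ * δ ≤ δ := mul_le_of_le_one_left hδ.le hθ₁1
      linarith only [e, h1, hδlo]
    have h1 : θ₁ * Λ' ≤ 12 * (ω ^ 2 * δ * rb) := by
      have h2 : θ₁ * Λ' ≤ θ₁ * (4 * ω ^ 2 * rb ^ 2) := mul_le_mul_of_nonneg_left hΛ4 hθ₁.le
      have h3 : θ₁ * (4 * ω ^ 2 * rb ^ 2) = 4 * ω ^ 2 * rb * (θ₁ * rb) := by ring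
      have h4 : 4 * ω ^ 2 * rb * (θ₁ * rb) ≤ 4 * ω ^ 2 * rb * (3 * δ) :=
        mul_le_mul_of_nonneg_left hδθ (by positivity)
      linarith only [h2, h3, h4]
    linarith only [hEΛ, h1, hJlo, hωδ]
  have hJlo0 : Es ≤ Jlo := by linarith only [hEJ, hJlo, hωδ]
  -- `k₀² := min(Δ(r_θ)·θ₁ω²/(512 r_b²), e₁)`
  set G₀ := delta M a (rPlus M a + θ * d) * (θ₁ * ω ^ 2 / (512 * rb ^ 2)) with hG₀
  have hG₀pos : 0 < G₀ := by rw [hG₀]; positivity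
  set k₀ := Real.sqrt (min G₀ e₁) with hk₀def
  have hmin0 : 0 < min G₀ e₁ := lt_min hG₀pos he₁0
  have hk₀sq : k₀ ^ 2 = min G₀ e₁ := Real.sq_sqrt hmin0.le
  have hk₀ : 0 < k₀ := Real.sqrt_pos.2 hmin0
  set k₁ := Real.sqrt (c₁ * δ / 8) with hk₁def
  have hk₁sq : k₁ ^ 2 = c₁ * δ / 8 := Real.sq_sqrt (by positivity)
  have hk₁ : 0 < k₁ := Real.sqrt_pos.2 (by positivity)
  clear_value k₀ k₁
  -- floors
  have hfl₁ : ∀ s ∈ Icc slo smid, k₁ ^ 2 ≤ sepPotential M a ω m Λ (ρ s) - ω ^ 2 := by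
    intro s hs
    have hs' : s ∈ Icc slo b₂ := ⟨hs.1, hs.2.trans hmidb⟩
    have h := (haff s hs').1
    have h1 : c₁ * (δ / 4) ≤ c₁ * (b₂ - s) :=
      mul_le_mul_of_nonneg_left (by linarith only [hs.2, hℓ₂]) hc₁0.le
    rw [hk₁sq]; linarith only [h, h1, h8]
  have hLb : b₂ - L ≤ b₂ := by linarith only [hL0]
  have hflA : ∀ s ∈ Icc slo (b₂ - L), e₁ ≤ sepPotential M a ω m Λ (ρ s) - ω ^ 2 := by
    intro s hs
    have hs' : s ∈ Icc slo b₂ := ⟨hs.1, hs.2.trans hLb⟩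
    have h := (haff s hs').1
    have h1 : c₁ * L ≤ c₁ * (b₂ - s) := mul_le_mul_of_nonneg_left (by linarith only [hs.2]) hc₁0.le
    linarith only [h, h1, hcL]
  have hfl₀ : ∀ s ∈ Icc sθ (b₂ - L), k₀ ^ 2 ≤ sepPotential M a ω m Λ (ρ s) - ω ^ 2 := by
    intro s hs
    rw [hk₀sq]
    rcases le_or_gt s slo with h | h
    · refine (min_le_left _ _).trans ?_
      have hθr : rPlus M a + θ * d ≤ ρ s := by rw [← hsθ]; exact (hρ.strictMono hMa).monotone hs.1
      have hrlo : ρ s ≤ rPlus M a + δ / 2 := by rw [← hslo]; exact (hρ.strictMono hMa).monotone h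
      have hrs0 : 0 < ρ s := hρ.pos hMa s
      have hrsb : ρ s ≤ rb := by linarith only [hrlo, hrbeq, hδ]
      have hAs : (ρ s ^ 2 + a ^ 2) ^ 2 ≤ 4 * rb ^ 4 := by
        have h5 : ρ s ^ 2 + a ^ 2 ≤ 2 * rb ^ 2 := by nlinarith only [ha2, hrsb, hrs0, hδrb, hδ, hrbeq, hrp]
        calc (ρ s ^ 2 + a ^ 2) ^ 2 ≤ (2 * rb ^ 2) ^ 2 := pow_le_pow_left₀ (by positivity) h5 2
          _ = 4 * rb ^ 4 := by ring
      have hAs0 : 0 < (ρ s ^ 2 + a ^ 2) ^ 2 := by positivity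
      rcases le_or_gt (ρ s) (rPlus M a * (1 + θ₁ / 8)) with h18 | h18
      · -- inner collar: `Δ(r_θ)θ₁Λ′/(16(ρ² + a²)²)` and `Λ′ ≥ ω² r_b²/8`, `(ρ² + a²)² ≤ 4 r_b⁴`
        have hc := negCoeff_ge_of_sliverCollar (ω := ω) (Λ := Λ) (m := m) ha hθ₁ hθ₁1 hBF hΛ'pos hrθp
          hθr h18 (by
            have e : 48 * ((rPlus M a ^ 2 + a ^ 2) * (ω - m * horizonAngularVelocity M a)) ^ 2 /
                (d * θ₁ ^ 2 * Λ') = 2 * Xs := by rw [hXs]; ring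
            rw [e]; linarith only [h2Xs])
        refine le_trans ?_ hc
        rw [hG₀]
        have hcmp : θ₁ * ω ^ 2 / (512 * rb ^ 2) ≤ θ₁ * Λ' / 16 / (ρ s ^ 2 + a ^ 2) ^ 2 := by
          rw [div_le_div_iff₀ (by positivity) hAs0]
          -- `θ₁ω² (ρ²+a²)² ≤ 4θ₁ω² r_b⁴ ≤ 32 θ₁ Λ′ r_b²`
          have h6 : θ₁ * ω ^ 2 * (ρ s ^ 2 + a ^ 2) ^ 2 ≤ θ₁ * ω ^ 2 * (4 * rb ^ 4) :=
            mul_le_mul_of_nonneg_left hAs (by positivity)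
          have h7 : θ₁ * rb ^ 2 * (ω ^ 2 * rb ^ 2) ≤ θ₁ * rb ^ 2 * (8 * Λ') :=
            mul_le_mul_of_nonneg_left hΛ8 (by positivity)
          nlinarith only [h6, h7]
        calc delta M a (rPlus M a + θ * d) * (θ₁ * ω ^ 2 / (512 * rb ^ 2))
            ≤ delta M a (rPlus M a + θ * d) * (θ₁ * Λ' / 16 / (ρ s ^ 2 + a ^ 2) ^ 2) :=
              mul_le_mul_of_nonneg_left hcmp hΔθ.le
          _ = _ := by ring
      · -- outer collar: fuzzed profile with `E ≤ J_lo/2`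
        have hr18 : rPlus M a * (1 + θ₁ / 8) ≤ ρ s := h18.le
        have hrζ : rPlus M a + θ₁ * M / 8 ≤ ρ s := by nlinarith only [hr18, hθM]
        have hlow := (hprof (ρ s) hrζ).1
        have hc := negCoeff_ge_of_layerCollar (ω := ω) (Λ := Λ) (m := m) ha hr18p hr18 hrlo
          (by linarith only [hlot, hδ]) hJrt hlow (by rw [← hJlodef]; exact hJlo0)
        rw [← hJlodef] at hc
        refine le_trans ?_ hc
        -- `G₀ ≤ Δ(r₁/₈)(J_lo − E)/(r_lo² + a²)²`: `J_lo − E ≥ J_lo/2 ≥ ω²δr_b/16`, denominator `≤ 4r_b⁴`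
        have h6 : ω ^ 2 * δ * rb / 16 ≤ Jlo - Es := by linarith only [hEJ, hJlo]
        have hδθ' : θ₁ * rb ≤ 3 * δ := by
          have e : θ₁ * rb = θ₁ * rPlus M a + θ₁ * δ := by rw [hδdef]; ring
          have h1 : θ₁ * δ ≤ δ := mul_le_of_le_one_left hδ.le hθ₁1
          linarith only [e, h1, hδlo]
        rw [hG₀]
        calc delta M a (rPlus M a + θ * d) * (θ₁ * ω ^ 2 / (512 * rb ^ 2))
            ≤ delta M a (rPlus M a * (1 + θ₁ / 8)) * ((ω ^ 2 * δ * rb / 16) / (4 * rb ^ 4)) := by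
              refine mul_le_mul hΔ18 ?_ (by positivity) (delta_nonneg ha.le hr18p.le)
              rw [div_le_div_iff₀ (by positivity) (by positivity)]
              -- `θ₁ ω² · 4 r_b⁴ · 16 ≤ ω² δ r_b · 512 r_b²` iff `θ₁ r_b ≤ 8 δ`
              have := mul_le_mul_of_nonneg_left hδθ' (show 0 ≤ 64 * ω ^ 2 * rb ^ 3 by positivity)
              have hp : 0 ≤ ω ^ 2 * δ * rb ^ 3 := by positivity
              linarith only [this, hp]
          _ ≤ delta M a (rPlus M a * (1 + θ₁ / 8)) * ((Jlo - Es) / ((rPlus M a + δ / 2) ^ 2 + a ^ 2) ^ 2) := by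
              refine mul_le_mul_of_nonneg_left ?_ (delta_nonneg ha.le hr18p.le)
              exact div_le_div₀ (by linarith only [h6, hωδ]) h6 hAlo0 hA4
          _ = _ := by ring
    · exact (min_le_right _ _).trans (hflA s ⟨h.le, hs.2⟩)
  have hflL : ∀ s ∈ Icc (b₂ - L) b₂, |sepPotential M a ω m Λ (ρ s) - ω ^ 2| ≤ KL ^ 2 := by
    intro s hs
    have hslo' : slo ≤ s := by linarith only [hs.1, hmidβ, hlomid, hθlo]
    have hs' : s ∈ Icc slo b₂ := ⟨hslo', hs.2⟩
    obtain ⟨h1, h2⟩ := haff s hs'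
    have h3 : c₂ * (b₂ - s) ≤ c₂ * L := mul_le_mul_of_nonneg_left (by linarith only [hs.1]) hc₂0
    have h4 : 0 ≤ c₁ * (b₂ - s) := mul_nonneg hc₁0.le (by linarith only [hs.2])
    rw [hKLsq, abs_le]
    constructor <;> nlinarith only [h1, h2, h3, h4, he₁0, he₂0, hc₂0, hL0]
  refine ⟨b₁, b₂, sθ, slo, smid, L, KL, k₀, k₁, hF, hφb₂, hb₂R, hrb_lo, hsθ, hb₁θ, hθlo, hlomid, hmidβ, hL0,
    hk₀, hfl₀, hk₁, hfl₁, hKL0, hflL, hKLL, hℓ, ?_, ?_, hL1, hL2, hΛ4, hf1⟩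
  · rw [hk₁sq]
    have : ω ^ 2 * δ ^ 5 / (1024 * rb ^ 5) = ω ^ 2 * δ ^ 4 / (128 * rb ^ 5) * δ / 8 := by
      field_simp; ring
    rw [this]
    exact div_le_div_of_nonneg_right (mul_le_mul_of_nonneg_right hc₁ge hδ.le) (by norm_num)
  · rw [hk₀sq]
    exact min_le_min le_rfl he₁ge

end LayerGeometry

end Kerr

end Literature.Geometry.Lorentzian

end
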